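import Mathlib.NumberTheory.NumberField.Basic
import Mathlib.LinearAlgebra.Dimension.Localization
import Mathlib.RingTheory.Localization.BaseChange
import Mathlib.RingTheory.Flat.TorsionFree
import Mathlib.RingTheory.Flat.EquationalCriterion
import Mathlib.Algebra.Module.FinitePresentation
import HarnessLib

/-!
# Modules over the ring of integers of a number field: `rank_ℤ M = [F : ℚ] · rank_{𝒪_F} M`,
# and finitely generated torsion-free `𝒪_F`-modules are projective

Topic `Literature/RingTheory/DedekindDomain`; namespace `Literature.RingTheory.DedekindDomain`.  THEOREMS ONLY (no definition, no
named fact, no instance, no notation, no `sorry`); Mathlib-only imports.  Cell `hodgecm-mathlib` (D-0151), FLOOR 0, P6 «MOD programme»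
(crux hLiu418 = stmt-HodgeConjecture-24832, `--supports`): FILE 1 of the GEN organ **(S-H-A) «TATE∕BETTI-MODULE COMPARISON FOR THE
`e_w`-COUNT»** (K∕BT desk F0P6d-plan (g2) cut v2.3 §2, socket (S-H); A-p18 (g30), 2026-09-01).  The use: for a complex abelian variety `A`
with `𝒪_F`-multiplication the lattice `Λ = H₁(A(ℂ); ℤ)` is a finitely generated torsion-free `𝒪_F`-module of `ℤ`-rank `2 dim A`; this file
supplies the two pieces of commutative algebra that turn that into the input of ★ `ProjectiveModuleTorsionQuotient` (DEAL 8: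
`Module.Finite`, `Module.Projective`, `Module.finrank 𝒪_F Λ = m`): (§1) a localisation of `𝒪_F`-modules at `(𝒪_F)⁰` is, as a `ℤ`-module,
the localisation at `ℤ⁰` (every nonzero algebraic integer divides a nonzero rational integer); (§2) **`rank_ℤ M = [F : ℚ] · rank_{𝒪_F} M`**
for EVERY `𝒪_F`-module `M` (both sides are generic ranks: `F ⊗_{𝒪_F} M` is at once the `F`-base change of `M` and the `ℤ⁰`-localisation
of the `ℤ`-module `M`); (§3) a module over `𝒪_F` that is torsion-free as an abelian group is torsion-free over `𝒪_F`, and a finitely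
generated torsion-free `𝒪_F`-module is projective (Dedekind: torsion-free ⇒ flat, finitely presented flat ⇒ projective).
HC_CM is proved only modulo the printed citations until rung 0 closes; this file is generic and changes no count.

THE PRINT.  [Neukirch1999] Ch. I §2 (2.10) (every element of `F` is `a ∕ n` with `a ∈ 𝒪_F`, `n ∈ ℤ`; `𝒪_F` is a free `ℤ`-module of rank
`[F : ℚ]`, (2.9)) and §3 (3.2)–(3.3) with the structure of finitely generated modules over a Dedekind domain, Ch. I §3 Exercise ∕
[CurtisReiner1962] §22 (22.5), (22.11): a finitely generated torsion-free module over a Dedekind domain `𝔬` is projective, `≅ 𝔬^{n-1} ⊕ 𝔞`,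
and its rank `n = dim_F (F ⊗_𝔬 M)`; for `𝔬 = 𝒪_F` one has `rank_ℤ M = [F : ℚ] · n` ([Shimura1998] §1.2–§1.3: a lattice in `F^n ⊗ ℝ` stable
under an order of `F` has `ℤ`-rank `n[F : ℚ]`).

* §1 `isLocalizedModule_int_nonZeroDivisors` — descent of the submonoid `(𝒪_F)⁰ ↦ ℤ⁰` for localised modules.
* §2 `finrank_rat_eq_finrank_int`, **`finrank_int_eq_finrank_rat_mul_finrank`** (`Module.finrank ℤ M = Module.finrank ℚ F * Module.finrank (𝓞 F) M`),
  `finrank_ringOfIntegers_eq_of_finrank_int_eq` (the solved form `finrank (𝓞 F) M = r` from `finrank ℤ M = [F:ℚ] · r`).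
* §3 `isTorsionFree_ringOfIntegers_of_int`, **`projective_of_isTorsionFree`**, `projective_of_isTorsionFree_int`.

## References
* [Neukirch1999] J. Neukirch, *Algebraic Number Theory* (1999), Ch. I §2 (2.9)–(2.10), §3 (3.2)–(3.3).
* [CurtisReiner1962] C. W. Curtis, I. Reiner, *Representation Theory of Finite Groups and Associative Algebras* (1962), §22, (22.5) and (22.11)
  (Steinitz: finitely generated torsion-free modules over Dedekind domains are projective, determined by rank and ideal class).
* [Shimura1998] G. Shimura, *Abelian Varieties with Complex Multiplication and Modular Functions* (1998), §1.2–§1.3 (lattices stable under an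
  order; `ℤ`-rank `n[F : ℚ]`).
-/

set_option autoImplicit false

namespace Literature.RingTheory.DedekindDomain

open scoped nonZeroDivisors TensorProduct
open NumberField Module

universe u v w

variable {F : Type u} [Field F] [NumberField F]

/-! ## §1 Localising an `𝒪_F`-module at `(𝒪_F)⁰` is localising the underlying `ℤ`-module at `ℤ⁰` -/

/-- **Descent of the submonoid `(𝒪_F)⁰ ↦ ℤ⁰`.**  If `f : M → N` exhibits `N` as the localisation of the `𝒪_F`-module `M` at all
nonzero elements of `𝒪_F`, then `f`, viewed `ℤ`-linearly, exhibits `N` as the localisation of the abelian group `M` at the nonzero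
integers: every nonzero `s ∈ 𝒪_F` divides a nonzero `n ∈ ℤ` (the constant term of a polynomial killing `s`, Mathlib
`IsAlgebraic.exists_nonzero_dvd`), so denominators in `𝒪_F ∖ 0` and in `ℤ ∖ 0` give the same fractions.
[cite: Neukirch1999, Ch. I §2 (2.10)] -/
theorem isLocalizedModule_int_nonZeroDivisors {M : Type v} {N : Type w} [AddCommGroup M] [Module (𝓞 F) M]
    [AddCommGroup N] [Module (𝓞 F) N] (f : M →ₗ[𝓞 F] N) [IsLocalizedModule (𝓞 F)⁰ f] :
    IsLocalizedModule ℤ⁰ (f.restrictScalars ℤ) := by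
  -- every nonzero algebraic integer divides a nonzero rational integer
  have hdvd : ∀ s : (𝓞 F)⁰, ∃ r : ℤ, r ≠ 0 ∧ ∃ t : 𝓞 F, (r : 𝓞 F) = (s : 𝓞 F) * t := fun s => by
    obtain ⟨r, hr0, t, ht⟩ :=
      ((Algebra.IsIntegral.isIntegral (R := ℤ) (s : 𝓞 F)).isAlgebraic).exists_nonzero_dvd s.2
    exact ⟨r, hr0, t, by rw [← ht, algebraMap_int_eq, Int.coe_castRingHom]⟩
  refine ⟨fun n => ?_, fun y => ?_, fun {x₁ x₂} h => ?_⟩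
  · -- `n ∈ ℤ⁰` acts invertibly on `N` because `(n : 𝒪_F) ∈ (𝒪_F)⁰` does
    have hn0 : ((n : ℤ) : 𝓞 F) ≠ 0 := by exact_mod_cast nonZeroDivisors.ne_zero n.2
    have hu := IsLocalizedModule.map_units f ⟨((n : ℤ) : 𝓞 F), mem_nonZeroDivisors_of_ne_zero hn0⟩
    rw [Module.End.isUnit_iff] at hu ⊢
    have heq : ⇑(algebraMap ℤ (Module.End ℤ N) (n : ℤ)) =
        ⇑(algebraMap (𝓞 F) (Module.End (𝓞 F) N) ((n : ℤ) : 𝓞 F)) := by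
      funext y
      rw [Module.algebraMap_end_apply, Module.algebraMap_end_apply, Int.cast_smul_eq_zsmul]
    rw [heq]
    exact hu
  · -- fractions with denominators in `(𝒪_F)⁰` are fractions with denominators in `ℤ⁰`
    obtain ⟨⟨m, s⟩, hms⟩ := IsLocalizedModule.surj (𝓞 F)⁰ f y
    obtain ⟨r, hr0, t, hrt⟩ := hdvd s
    refine ⟨⟨t • m, ⟨r, mem_nonZeroDivisors_of_ne_zero hr0⟩⟩, ?_⟩
    change (⟨r, _⟩ : ℤ⁰) • y = f (t • m)
    rw [Submonoid.mk_smul, ← Int.cast_smul_eq_zsmul (𝓞 F) r y, hrt, mul_comm, mul_smul, map_smul]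
    change t • (s • y) = t • f m
    rw [hms]
  · obtain ⟨s, hs⟩ := IsLocalizedModule.exists_of_eq (S := (𝓞 F)⁰) (f := f) (x₁ := x₁) (x₂ := x₂) h
    obtain ⟨r, hr0, t, hrt⟩ := hdvd s
    refine ⟨⟨r, mem_nonZeroDivisors_of_ne_zero hr0⟩, ?_⟩
    rw [Submonoid.mk_smul, Submonoid.mk_smul, ← Int.cast_smul_eq_zsmul (𝓞 F) r x₁,
      ← Int.cast_smul_eq_zsmul (𝓞 F) r x₂, hrt, mul_comm, mul_smul, mul_smul]
    change t • (s • x₁) = t • (s • x₂)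
    rw [hs]

/-! ## §2 `rank_ℤ M = [F : ℚ] · rank_{𝒪_F} M` -/

/-- For a `ℚ`-vector space `N`, `ℚ`-rank and `ℤ`-rank agree (`ℚ = ℤ[(ℤ⁰)⁻¹]`; Mathlib `IsLocalization.rank_eq`).
[cite: Neukirch1999, Ch. I §2 (2.10)] -/
theorem finrank_rat_eq_finrank_int (N : Type w) [AddCommGroup N] [Module ℚ N] :
    Module.finrank ℚ N = Module.finrank ℤ N := by
  unfold Module.finrank
  rw [IsLocalization.rank_eq ℚ ℤ⁰ le_rfl]

/-- **`rank_ℤ M = [F : ℚ] · rank_{𝒪_F} M` for every `𝒪_F`-module `M`** (generic ranks, Mathlib `Module.finrank`): the vector space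
`F ⊗_{𝒪_F} M` is the `F`-base change of `M` (so its `F`-dimension is `rank_{𝒪_F} M`, Mathlib `IsBaseChange.finrank_eq`), it has
`ℚ`-dimension `[F : ℚ]` times that, and it is the localisation of the abelian group `M` at `ℤ⁰` (§1), so its `ℚ`-dimension is also
`rank_ℤ M`.  For a lattice with `𝒪_F`-multiplication: `ℤ`-rank `= [F : ℚ] ·` (`𝒪_F`-rank).
[cite: Shimura1998, §1.2–§1.3] [cite: Neukirch1999, Ch. I §2 (2.9)–(2.10)] -/
theorem finrank_int_eq_finrank_rat_mul_finrank (M : Type v) [AddCommGroup M] [Module (𝓞 F) M] :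
    Module.finrank ℤ M = Module.finrank ℚ F * Module.finrank (𝓞 F) M := by
  let f : M →ₗ[𝓞 F] F ⊗[𝓞 F] M := TensorProduct.mk (𝓞 F) F M 1
  have bc : IsBaseChange F f := TensorProduct.isBaseChange (𝓞 F) M F
  haveI : IsLocalizedModule (𝓞 F)⁰ f := IsLocalization.tensorProduct_isLocalizedModule (𝓞 F)⁰ F
  haveI : IsLocalizedModule ℤ⁰ (f.restrictScalars ℤ) := isLocalizedModule_int_nonZeroDivisors f
  haveI : FaithfulSMul (𝓞 F) F :=
    (faithfulSMul_iff_algebraMap_injective (𝓞 F) F).2 (IsFractionRing.injective (𝓞 F) F)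
  have h1 : Module.finrank F (F ⊗[𝓞 F] M) = Module.finrank (𝓞 F) M := bc.finrank_eq
  have h2 : Module.finrank ℚ F * Module.finrank F (F ⊗[𝓞 F] M) = Module.finrank ℚ (F ⊗[𝓞 F] M) :=
    Module.finrank_mul_finrank ℚ F (F ⊗[𝓞 F] M)
  have h3 : Module.finrank ℚ (F ⊗[𝓞 F] M) = Module.finrank ℤ (F ⊗[𝓞 F] M) := finrank_rat_eq_finrank_int _
  have h4 : Module.finrank ℤ (F ⊗[𝓞 F] M) = Module.finrank ℤ M :=
    IsLocalizedModule.finrank_eq ℤ⁰ (f.restrictScalars ℤ) le_rfl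
  rw [← h4, ← h3, ← h2, h1]

/-- **Solved form**: if `rank_ℤ M = [F : ℚ] · r` then `rank_{𝒪_F} M = r` (e.g. `H₁(A(ℂ); ℤ)` of `ℤ`-rank `2 dim A` with
`𝒪_F`-multiplication, `dim A = [F : ℚ]`: `𝒪_F`-rank `2`). [cite: Shimura1998, §1.2–§1.3] -/
theorem finrank_ringOfIntegers_eq_of_finrank_int_eq (M : Type v) [AddCommGroup M] [Module (𝓞 F) M] {r : ℕ}
    (h : Module.finrank ℤ M = Module.finrank ℚ F * r) : Module.finrank (𝓞 F) M = r := by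
  rw [finrank_int_eq_finrank_rat_mul_finrank (F := F) M] at h
  exact Nat.eq_of_mul_eq_mul_left Module.finrank_pos h

/-! ## §3 Torsion-freeness over `𝒪_F` from torsion-freeness over `ℤ`; projectivity -/

omit [NumberField F] in
/-- **An `𝒪_F`-module without `ℤ`-torsion has no `𝒪_F`-torsion**: a nonzero `s ∈ 𝒪_F` divides a nonzero integer `n = s t`, so
`s • x = s • y` gives `n • x = t • s • x = t • s • y = n • y`, hence `x = y`. [cite: Neukirch1999, Ch. I §2 (2.10)] -/
theorem isTorsionFree_ringOfIntegers_of_int (M : Type v) [AddCommGroup M] [Module (𝓞 F) M] [Module.IsTorsionFree ℤ M] :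
    Module.IsTorsionFree (𝓞 F) M := by
  refine ⟨fun s hs x y hxy => ?_⟩
  have hs0 : s ≠ 0 := hs.ne_zero
  obtain ⟨r, hr0, t, ht⟩ :=
    ((Algebra.IsIntegral.isIntegral (R := ℤ) s).isAlgebraic).exists_nonzero_dvd (mem_nonZeroDivisors_of_ne_zero hs0)
  have hrt : (r : 𝓞 F) = s * t := by rw [← ht, algebraMap_int_eq, Int.coe_castRingHom]
  have hreg : IsRegular (r : ℤ) := IsRegular.of_ne_zero hr0
  apply hreg.isSMulRegular (M := M)
  change (r : ℤ) • x = (r : ℤ) • y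
  have hxy' : s • x = s • y := hxy
  rw [← Int.cast_smul_eq_zsmul (𝓞 F) r x, ← Int.cast_smul_eq_zsmul (𝓞 F) r y, hrt, mul_comm, mul_smul,
    mul_smul, hxy']

/-- **A finitely generated torsion-free `𝒪_F`-module is projective** (over a Dedekind domain torsion-free ⇒ flat, and a finitely
presented flat module is projective; Mathlib). [cite: CurtisReiner1962, §22 (22.5)] -/
theorem projective_of_isTorsionFree (M : Type v) [AddCommGroup M] [Module (𝓞 F) M] [Module.Finite (𝓞 F) M]
    [Module.IsTorsionFree (𝓞 F) M] : Module.Projective (𝓞 F) M := by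
  haveI : Module.Flat (𝓞 F) M := inferInstance
  haveI : Module.FinitePresentation (𝓞 F) M := Module.finitePresentation_of_finite (𝓞 F) M
  exact Module.Flat.projective_of_finitePresentation

/-- **A finitely generated `𝒪_F`-module without `ℤ`-torsion is projective** (the form a lattice `Λ ≅ ℤ^{N}` with `𝒪_F`-multiplication
arrives in). [cite: CurtisReiner1962, §22 (22.5)] -/
theorem projective_of_isTorsionFree_int (M : Type v) [AddCommGroup M] [Module (𝓞 F) M] [Module.Finite (𝓞 F) M]
    [Module.IsTorsionFree ℤ M] : Module.Projective (𝓞 F) M := by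
  haveI := isTorsionFree_ringOfIntegers_of_int (F := F) M
  exact projective_of_isTorsionFree (F := F) M

end Literature.RingTheory.DedekindDomain
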